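import Summits.BirchSwinnertonDyer.BirchSwinnertonDyer.Theses.QuadraticBranchSignedControl
import Summits.BirchSwinnertonDyer.BirchSwinnertonDyer.Theorems.QuadraticBranchSignedControlThm74OfColemanPoitouTateFact
import Summits.BirchSwinnertonDyer.BirchSwinnertonDyer.Theorems.QuadraticBranchSignedControlPlusLowerInclusionUnitRows
import Literature.NumberTheory.EllipticCurves.Kobayashi2003.EtaColemanPoitouTateZetaSequences
import Literature.NumberTheory.EllipticCurves.Kobayashi2003.SignedSelmerTorsion
import HarnessLib

/-!
# K8 route `QuadraticBranchSignedControl`: Kobayashi Thm. 2.2 at the quadratic `η` FROM the Coleman /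
# Poitou–Tate package, and the glue of crux `PlusLowerInclusionSurjBranch` WITHOUT the held input
# `PublishedInputKobThm22Lower` (Thm. 2.2η) — it is subsumed by the zeta-eta package the route holds anyway

Cell `bsd-potss` (HOME `run/shared/lean/pub/bsd-potss/`), seat `bsd-potss-k8q-c2x` g4 (prover; lane B of the K8
Kato side; director-bsd g8 2026-08-27: "signed Coleman maps giving Kato divisibility in the plus theory BY
NAME"). HONEST FRAMING: the programme assembles BSD for analytic rank `≤ 1` strictly from published theorems and
types the remainder; BSD is not proved by any of this; every theorem below is CONDITIONAL on named Literature
facts and/or open route items displayed as hypotheses; nothing is closed unconditionally; nothing is booked.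

## What

After the planner's split of crux 20445 `PlusKatoDivisibilityBranchOnto`, the route HOLDS (as by-name aliases)
`hZ` = `Kobayashi2003.thm62_63_73_etaColemanPoitouTate_zeta` (Kobayashi 2003 Thm. 6.2/6.3/7.3 i)/Cor. 7.2 at
`η` on pinned objects, `z` a genuine Euler-system class). The glue 19605 of the Eisenstein crux
`PlusLowerInclusionSurjBranch` (`PlusEtaLowerInclusion → EtaDescentFrameSurj → PublishedInputKobThm12Lower →
PublishedInputKobThm22Lower → PlusLowerInclusionSurjBranch`, lane A) consumes Kobayashi's Thm. 2.2 at `η`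
(`thm22_etaSignedSelmerDual_finite_torsion`, held item 19604) for ONE purpose: finite generation and torsion of
the `η`-component dual datum, so that characteristic ideals multiply over `X⁺(V'/F_∞) ≃ X⁺(V/ℚ_∞) × X(Dη)`.
On the frames where the glue uses it (a newform `f` of `V`, a period ratio, `η ≠ 1`) that is EXACTLY
Kobayashi's Thm. 7.3 ii) argument from the package: along `Λ/(L_p⁺(V,η,X)) → X(Dη) → X⁰ → 0` ((7.21) at `η`),
`L_p⁺ ≠ 0` (Rohrlich) and `X⁰` finitely generated torsion (Cor. 7.2) give both ("Admitting Theorem 6.2 and 6.3,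
we prove Theorem 2.2 and 4.1", p. 11). Hence:
* §1 `finite_isTorsion_etaSignedSelmerDual_of_etaColemanPoitouTate` / `…_of_zeta`: **Kobayashi Thm. 2.2 at the
  quadratic `η`, BOTH signs, finite generation AND torsion, on every newform frame, from the package fact alone**
  (the tree had the torsion clause: `Thm74Skeleton.isTorsion_etaSignedSelmerDual_of_etaColemanPoitouTate`);
* §2 `quadraticBranchPlusLowerInclusionAt_of_etaLowerInclusion_of_zeta`: lane A's per-pair transport
  (`…_of_etaLowerInclusion_of_decomposition`, p421483) with `h22` REPLACED by `hZ`;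
* §3 **`plusLowerInclusionSurjBranch_of_eta_of_thm12_of_zeta : PlusEtaLowerInclusion → EtaDescentFrameSurj →
  PublishedInputKobThm12Lower → hZ → PlusLowerInclusionSurjBranch`** — the crux's glue with the held input
  `PublishedInputKobThm22Lower` replaced by the zeta-eta package; for the planner: 19604 may leave the cone
  (net −1 held Literature input; `thm22_etaSignedSelmerDual_finite_torsion` is then used nowhere in K8's
  deciding chain).

References: [Kobayashi2003] Thm. 2.2 (p. 5), Thm. 6.2, 6.3 (p. 11), Cor. 7.2, Thm. 7.3 ii) and (7.21) (p. 13),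
§4 (p. 8), §7 first paragraph (p. 11); [GreenbergLNM1716] §3 (descent; reading); [Washington1997] §13.2.
-/

noncomputable section

-- justification: the `Summit.BirchSwinnertonDyer.BirchSwinnertonDyer.…` path repeats a component (route-file convention)
set_option linter.dupNamespace false

open scoped Classical

open CongruenceSubgroup Field WeierstrassCurve
open Literature.NumberTheory.EllipticCurves
open Literature.NumberTheory.EllipticCurves.ModularForms
open Literature.NumberTheory.GaloisRepresentations
open Summit.BirchSwinnertonDyer.Rank1Residual.Additive hiding EtaSignedSelmerDualData
open Summit.BirchSwinnertonDyer.Rank1Residual.Additive.SignedTwist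
open Summit.BirchSwinnertonDyer.BirchSwinnertonDyer.Theses.QuadraticBranchSignedControl

namespace Summit.BirchSwinnertonDyer.BirchSwinnertonDyer.Theorems

namespace KatoSideOnto

/-! ## §1 Kobayashi Thm. 2.2 at the quadratic `η` (both signs, finite generation and torsion) from the package -/

/-- **Kobayashi 2003 Thm. 2.2 at the quadratic `η = ω^{(p−1)/2}`, both signs — every Pontryagin-dual datum of
`Sel^±(V/K_∞)^η` is finitely generated AND torsion over `Λ` — on every newform frame, FROM the Coleman /
Poitou–Tate package `thm62_63_73_etaColemanPoitouTate`** (Kobayashi's own route: Thm. 7.3 ii) — along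
`Λ/(L) → X(D) → X⁰(W/ℚ_∞) → 0` with `L = L_p⁺(V, η, X)`, resp. `X⁻¹L_p⁻(V, η, X)`, non-zero by Rohrlich, and
`X⁰` finitely generated torsion (Cor. 7.2): `Module.Finite.of_exact` and `Thm74Skeleton.isTorsion_of_exact`).
Frame = the fact's: `p` odd, `K₀ = ℚ(μ_p)`, `ηq` trivial on `Gal(ℚ̄/K₀)` and `≠ 1`, `V` globally minimal good at
`p` with `a_p = 0`, newform `f`, period ratio `ϖ`, cyclotomic `(κ, γ)` with `γ ∈ Gal(ℚ̄/K₀)` matching the variable.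
CONDITIONAL on the package fact. [cite: Kobayashi2003, Thm. 2.2 (p. 5), Thm. 7.3 ii) and its proof (p. 13), Cor. 7.2 (p. 13), §7 (p. 11)] -/
theorem finite_isTorsion_etaSignedSelmerDual_of_etaColemanPoitouTate
    (h : Kobayashi2003.thm62_63_73_etaColemanPoitouTate)
    {p : ℕ} [Fact p.Prime] (K₀ : Type) [Field K₀] [NumberField K₀] [IsCyclotomicExtension {p} ℚ K₀]
    [(galRange (K := ℚ) K₀).Normal] (ηq : absoluteGaloisGroup ℚ →* ℤˣ)
    (hηK : ∀ σ ∈ galRange (K := ℚ) K₀, ηq σ = 1) (hη1 : ηq ≠ 1)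
    (V : WeierstrassCurve ℚ) [V.IsElliptic] [V.IsGloballyMinimal] {N : ℕ} [NeZero N]
    {f : CuspForm (Gamma0 N) 2} (hp2 : p ≠ 2) (hgood : V.HasGoodReductionAtPrime p)
    (hap : V.frobeniusTrace p = 0) (hf : IsNewformOf V f) (ϖ : ℚ)
    (hϖ : if Even (p / 2) then (ϖ : ℝ) * V.realPeriodRat = plusPeriod f
      else (ϖ : ℝ) * V.imaginaryPeriodRat = minusPeriod f)
    (κ : ZpExtension ℚ p) (γ : absoluteGaloisGroup ℚ) (hκ : κ.IsCyclotomic) (hγ : κ.IsTopGenerator γ)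
    (hγK : γ ∈ galRange (K := ℚ) K₀) (hγc : IsCyclotomicVariable p γ) :
    (∀ D : Kobayashi2003.EtaSignedSelmerDualData V κ K₀ ℚ_[p] ηq γ 1,
        Module.Finite (IwasawaAlgebra p) D.X ∧ Module.IsTorsion (IwasawaAlgebra p) D.X) ∧
      (∀ D : Kobayashi2003.EtaSignedSelmerDualData V κ K₀ ℚ_[p] ηq γ (-1),
        Module.Finite (IwasawaAlgebra p) D.X ∧ Module.IsTorsion (IwasawaAlgebra p) D.X) := by
  obtain ⟨A, B, _, _, _, _, hBfin, hBtors, ⟨Lp, hLp, hplus⟩, ⟨Lm, hLm, hminus⟩⟩ :=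
    Thm74Skeleton.thm74proof_etaExactSequences_of_etaColemanPoitouTate h p K₀ ηq hηK hη1 V hp2 hgood hap
      hf ϖ hϖ κ γ hκ hγ hγK hγc
  obtain ⟨htp, htm⟩ :=
    Thm74Skeleton.isTorsion_etaSignedSelmerDual_of_etaColemanPoitouTate h p K₀ ηq hηK hη1 V hp2 hgood hap
      hf ϖ hϖ κ γ hκ hγ hγK hγc
  haveI : Module.Finite (IwasawaAlgebra p) B := hBfin
  -- `L_p⁻ = X · L'`
  obtain ⟨L', hL'⟩ : ∃ L' : IwasawaAlgebra p, Lm = PowerSeries.X * L' := PowerSeries.X_dvd_iff.mpr hLm.1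
  refine ⟨fun D => ⟨?_, htp D⟩, fun D => ⟨?_, htm D⟩⟩
  · obtain ⟨i, j, k, -, -, hjk, hk⟩ := hplus D
    exact Module.Finite.of_exact hjk hk
  · obtain ⟨i, j, k, -, -, hjk, hk⟩ := hminus D L' hL'
    exact Module.Finite.of_exact hjk hk

/-- **Kobayashi Thm. 2.2 at the quadratic `η` (both signs, finite generation and torsion) on every newform
frame, FROM THE ZETA-PINNED PACKAGE `hZ`** — the fact the route holds as a child of crux 20445 (projection
`thm62_63_73_etaColemanPoitouTate_of_zeta`, then §1). CONDITIONAL on `hZ`.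
[cite: Kobayashi2003, Thm. 2.2 (p. 5), Thm. 7.3 ii) (p. 13), Cor. 7.2 (p. 13)] -/
theorem finite_isTorsion_etaSignedSelmerDual_of_zeta
    (hZ : Kobayashi2003.thm62_63_73_etaColemanPoitouTate_zeta)
    {p : ℕ} [Fact p.Prime] (K₀ : Type) [Field K₀] [NumberField K₀] [IsCyclotomicExtension {p} ℚ K₀]
    [(galRange (K := ℚ) K₀).Normal] (ηq : absoluteGaloisGroup ℚ →* ℤˣ)
    (hηK : ∀ σ ∈ galRange (K := ℚ) K₀, ηq σ = 1) (hη1 : ηq ≠ 1)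
    (V : WeierstrassCurve ℚ) [V.IsElliptic] [V.IsGloballyMinimal] {N : ℕ} [NeZero N]
    {f : CuspForm (Gamma0 N) 2} (hp2 : p ≠ 2) (hgood : V.HasGoodReductionAtPrime p)
    (hap : V.frobeniusTrace p = 0) (hf : IsNewformOf V f) (ϖ : ℚ)
    (hϖ : if Even (p / 2) then (ϖ : ℝ) * V.realPeriodRat = plusPeriod f
      else (ϖ : ℝ) * V.imaginaryPeriodRat = minusPeriod f)
    (κ : ZpExtension ℚ p) (γ : absoluteGaloisGroup ℚ) (hκ : κ.IsCyclotomic) (hγ : κ.IsTopGenerator γ)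
    (hγK : γ ∈ galRange (K := ℚ) K₀) (hγc : IsCyclotomicVariable p γ) :
    (∀ D : Kobayashi2003.EtaSignedSelmerDualData V κ K₀ ℚ_[p] ηq γ 1,
        Module.Finite (IwasawaAlgebra p) D.X ∧ Module.IsTorsion (IwasawaAlgebra p) D.X) ∧
      (∀ D : Kobayashi2003.EtaSignedSelmerDualData V κ K₀ ℚ_[p] ηq γ (-1),
        Module.Finite (IwasawaAlgebra p) D.X ∧ Module.IsTorsion (IwasawaAlgebra p) D.X) :=
  finite_isTorsion_etaSignedSelmerDual_of_etaColemanPoitouTate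
    (Kobayashi2003.thm62_63_73_etaColemanPoitouTate_of_zeta hZ) K₀ ηq hηK hη1 V hp2 hgood hap hf ϖ hϖ κ γ
    hκ hγ hγK hγc

/-! ## §2 (E⁺) at a pair from (E⁺_η), the frame, Thm. 1.2 and the package (in place of Thm. 2.2η) -/

/-- **(E⁺) `QuadraticBranchPlusLowerInclusionAt V p` AT A PAIR from the Eisenstein inclusion stated VERBATIM on the
`η`-component object, granted the ∀-form frame `hdec`, Thm. 1.2 (`h12`) and the ZETA-PINNED PACKAGE `hZ` in place
of Thm. 2.2η** — lane A's `quadraticBranchPlusLowerInclusionAt_of_etaLowerInclusion_of_decomposition` (p421483)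
with its single use of `h22` (finite generation and torsion of the `η`-datum) served by §1 on the pair's own
newform frame; needs `ηq ≠ 1` in addition. `Char DF = Char D · Char Dη ⊆ Char D · (Lη)`. CONDITIONAL; closes
nothing. [cite: Kobayashi2003, Thm. 1.2 (p. 2), Thm. 2.2 (p. 5), Thm. 7.3 ii) (p. 13), §4 (p. 8)]
[cite: Washington1997, §13.2 (characteristic ideals over Λ)] [cite: GreenbergLNM1716, §3 (descent; reading)] -/
theorem quadraticBranchPlusLowerInclusionAt_of_etaLowerInclusion_of_zeta
    {V : WeierstrassCurve ℚ} [V.IsElliptic] [V.IsGloballyMinimal] {p : ℕ} [Fact p.Prime]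
    (h12 : Kobayashi2003.thm12_signedSelmerDual_finite_torsion)
    (hZ : Kobayashi2003.thm62_63_73_etaColemanPoitouTate_zeta)
    (K₀ : Type) [Field K₀] [NumberField K₀] [IsCyclotomicExtension {p} ℚ K₀]
    [(galRange (K := ℚ) K₀).Normal] (ηq : absoluteGaloisGroup ℚ →* ℤˣ)
    (hηK : ∀ σ ∈ galRange (K := ℚ) K₀, ηq σ = 1) (hη1 : ηq ≠ 1)
    (hdec : ∀ (κ : ZpExtension ℚ p) (γ : absoluteGaloisGroup ℚ),
        κ.IsCyclotomic → κ.IsTopGenerator γ → γ ∈ galRange (K := ℚ) K₀ →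
        IsCyclotomicVariable p γ →
      ∀ (F : Type) [Field F] [NumberField F] (V' : WeierstrassCurve F) [V'.IsElliptic]
        (κF : ZpExtension F p) (γF : absoluteGaloisGroup F),
        Module.finrank ℚ F = 2 → (∃ θ : F, θ ^ 2 = algebraMap ℚ F ((-1) ^ (p / 2) * p)) →
        (∃ C : VariableChange F, C • V.baseChange F = V') →
        κF.IsCyclotomic → κF.IsTopGenerator γF →
        (∃ ζ : ℤ_[p]ˣ, IsOfFinOrder ζ ∧
          ((GaloisRep.cyclotomicCharacter F p γF * ζ : ℤ_[p]ˣ) : ℤ_[p]) =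
            (cyclotomicGenerator p : ℤ_[p])) →
      ∃ Φ : Kobayashi2003.signedSelmerInfty V' κF 1 ≃+
          Kobayashi2003.signedSelmerInfty V κ 1 × towerSignedSelmerInftyEta V κ K₀ ℚ_[p] ηq 1,
        ∀ s : Kobayashi2003.signedSelmerInfty V' κF 1,
          ((Φ ⟨V'.conjH1 p κF.kerSubgroup γF s,
              Kobayashi2003.conjH1_mem_signedSelmerInfty V' κF 1 γF s.2⟩).1 :
              V.subgroupH1 p κ.kerSubgroup) =
            V.conjH1 p κ.kerSubgroup γ (Φ s).1 ∧
          ((Φ ⟨V'.conjH1 p κF.kerSubgroup γF s,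
              Kobayashi2003.conjH1_mem_signedSelmerInfty V' κF 1 γF s.2⟩).2 :
              V.subgroupH1 p (towerTopSubgroup κ K₀)) =
            V.conjH1 p (towerTopSubgroup κ K₀) γ (Φ s).2)
    (hEη : ∀ {N : ℕ} [NeZero N] {f : CuspForm (Gamma0 N) 2},
        p ≠ 2 → V.HasGoodReductionAtPrime p → V.frobeniusTrace p = 0 → IsNewformOf V f →
      ∀ (ϖ : ℚ), (if Even (p / 2) then (ϖ : ℝ) * V.realPeriodRat = plusPeriod f
          else (ϖ : ℝ) * V.imaginaryPeriodRat = minusPeriod f) →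
      ∀ (Lη : IwasawaAlgebra p), IsQuadraticBranchPlusLFunction f p ϖ Lη →
      ∀ (κ : ZpExtension ℚ p) (γ : absoluteGaloisGroup ℚ),
        κ.IsCyclotomic → κ.IsTopGenerator γ → γ ∈ galRange (K := ℚ) K₀ →
        IsCyclotomicVariable p γ →
      ∀ (D : Summit.BirchSwinnertonDyer.Rank1Residual.Additive.EtaSignedSelmerDualData V κ K₀ ℚ_[p] ηq γ 1),
        D.charIdeal ≤ Ideal.span {Lη}) :
    QuadraticBranchPlusLowerInclusionAt V p := by
  intro F _ _ V' _ κ γ κF γF N _ f hp2 hgood hap hF hθ hC hκ hγ hγc hκF hγF hζ hf ϖ hϖ Lη hL D DF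
  obtain ⟨γ', hγ'K, hγ', hγ'c, Dη, ⟨e⟩⟩ :=
    exists_etaDatum_prod_linearEquiv_of_decomposition K₀ ηq hdec F V' hF hθ hC hκ hγ hγc hκF hγF hζ
      D DF
  -- finiteness: Thm. 1.2 for `D`; the package (Thm. 7.3 ii) at `η`) for `Dη` through the Literature copy
  obtain ⟨hDfin, hDtor⟩ := h12 V p hp2 hgood hap κ γ hκ hγ 1 D
  let Dη' : Literature.NumberTheory.EllipticCurves.Kobayashi2003.EtaSignedSelmerDualData
      V κ K₀ ℚ_[p] ηq γ' 1 :=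
    { X := Dη.X
      conj_mem := Dη.conj_mem
      toDual := Dη.toDual
      bijective := Dη.bijective
      toDual_T_smul := Dη.toDual_T_smul
      toDual_C_smul := Dη.toDual_C_smul }
  obtain ⟨hηfin, hηtor⟩ :=
    (finite_isTorsion_etaSignedSelmerDual_of_zeta hZ K₀ ηq hηK hη1 V hp2 hgood hap hf ϖ hϖ κ γ' hκ hγ'
      hγ'K hγ'c).1 Dη'
  haveI : Module.Finite (IwasawaAlgebra p) D.X := hDfin
  haveI : Module.Finite (IwasawaAlgebra p) Dη.X := hηfin
  have hPtor : Module.IsTorsion (IwasawaAlgebra p) (D.X × Dη.X) :=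
    isTorsion_prod_of_isTorsion hDtor hηtor
  have hPchar : Module.charIdeal (IwasawaAlgebra p) (D.X × Dη.X) =
      Module.charIdeal (IwasawaAlgebra p) D.X * Module.charIdeal (IwasawaAlgebra p) Dη.X :=
    charIdeal_mul_of_shortExact_holds p (D.X × Dη.X) hPtor
      (LinearMap.inl (IwasawaAlgebra p) D.X Dη.X) (LinearMap.snd (IwasawaAlgebra p) D.X Dη.X)
      LinearMap.inl_injective LinearMap.snd_surjective .inl_snd
  change Module.charIdeal (IwasawaAlgebra p) DF.X ≤
    Module.charIdeal (IwasawaAlgebra p) D.X * Ideal.span {Lη}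
  rw [Module.charIdeal_eq_of_linearEquiv e, hPchar]
  exact Ideal.mul_mono_right (hEη hp2 hgood hap hf ϖ hϖ Lη hL κ γ' hκ hγ' hγ'K hγ'c Dη)

/-! ## §3 The crux glue WITHOUT `PublishedInputKobThm22Lower` -/

/-- **Crux `PlusLowerInclusionSurjBranch` from its children WITH `PublishedInputKobThm22Lower` REPLACED by the
zeta-eta package the route holds for crux 20445**: `PlusEtaLowerInclusion → EtaDescentFrameSurj →
PublishedInputKobThm12Lower → Kobayashi2003.thm62_63_73_etaColemanPoitouTate_zeta → PlusLowerInclusionSurjBranch`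
— glue 19605 (`plusLowerInclusionSurjBranchOfEta_proof`, lane A / k8eta-c1) re-run over §2 at `K₀ = ℚ(ζ_p)` with
Kobayashi's `η` (`exists_theta_eta_cyclotomicField`). GLUE ONLY (implication); every antecedent stays in
hypothesis position (the `η`-node lower inclusion is OPEN class-wide; Thm. 1.2 and the package are held named
facts). For the tenure planner: with this term the held child 19604 `PublishedInputKobThm22Lower` is no longer
needed by the deciding chain. [cite: Kobayashi2003, Thm. 1.2 (p. 2), Thm. 2.2 (p. 5), Thm. 7.3 ii) (p. 13), §4 Even main [C] (p. 8), §3 (p. 5)]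
[cite: GreenbergLNM1716, §3 (descent in prime-to-p extensions; reading)] -/
theorem plusLowerInclusionSurjBranch_of_eta_of_thm12_of_zeta (hE : PlusEtaLowerInclusion)
    (hdec : EtaDescentFrameSurj) (h12 : PublishedInputKobThm12Lower)
    (hZ : Kobayashi2003.thm62_63_73_etaColemanPoitouTate_zeta) : PlusLowerInclusionSurjBranch := by
  intro V _ _ p _ hp5 hgood hap hs
  have hp2 : p ≠ 2 := by omega
  haveI : NeZero p := ⟨(Fact.out : p.Prime).ne_zero⟩
  haveI : IsCyclotomicExtension {p} ℚ (CyclotomicField p ℚ) :=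
    CyclotomicField.isCyclotomicExtension p ℚ
  haveI : (galRange (K := ℚ) (CyclotomicField p ℚ)).Normal := normal_galRange_cyclotomic p _
  obtain ⟨θ, ηq, -, -, -, hηK, hη1⟩ := exists_theta_eta_cyclotomicField p hp2
  exact quadraticBranchPlusLowerInclusionAt_of_etaLowerInclusion_of_zeta h12 hZ (CyclotomicField p ℚ) ηq hηK
    hη1
    (fun κ γ hκ hγ hγK hγc F _ _ V' _ κF γF hF hθ hC hκF hγF hζ =>
      hdec p hp5 (CyclotomicField p ℚ) ηq hηK hη1 V hgood hap hs κ γ hκ hγ hγK hγc F V' κF γF hF hθ hC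
        hκF hγF hζ)
    (fun hp2' hgood' hap' hf ϖ hϖ Lη hL κ γ hκ hγ hγK hγc Dη =>
      hE V p hp5 hgood hap hs (CyclotomicField p ℚ) ηq hηK hη1 hp2' hgood' hap' hf ϖ hϖ Lη hL κ γ hκ hγ
        hγK hγc Dη)

end KatoSideOnto

end Summit.BirchSwinnertonDyer.BirchSwinnertonDyer.Theorems

end
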